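import Mathlib
import Literature.NumberTheory.LFunctions.Zhang2022.TypedSection15ASubsteps
import Literature.NumberTheory.LFunctions.Zhang2022.Section15U012
import HarnessLib

/-!
# Zhang (2022) §15, `Z22:§15.u012a` kernel-checked: the exact double-sum identity behind (15.4)

Topic `Literature/NumberTheory/LFunctions/Zhang2022` (Landau–Siegel audit tree; verdict-neutral; ZHANG-L discharge
lane, WP15). Y. Zhang, *Discrete mean estimates and the Landau–Siegel zero*, arXiv:2211.02515v1 (2022)
[Zhang2022LandauSiegel] — **an unrefereed manuscript under adjudication**; this file PROVES the lane's typed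
sub-node `Typed.Section15A.Step15_u012a` (`TypedSection15ASubsteps`, zl-w15-typer: "the identity behind «it follows
that»", §15 p. 81, tex L4041–L4052) and asserts nothing about Theorems 1–2 of the source.

* `step15_u012a_holds : ∀ c′, Step15_u012a c′` — from `Typed.Section15A.sumPrim_integral_eq_tsum`
  (`Section15U012`): re-index the `j`-series over the multiples `j = Dm` (`Function.Injective.tsum_eq`),
  exchange the finite `n`-sum with the `m`-series (`SmoothWeight.summable_sum_term_mul`), rewrite
  `Σ_{ψ ≠ 1} ψ(n)ψ⁻¹(Dm) = Σ*_ψ ψ(n)ψ̄(Dm)` and `(Dm)^{−s₀′}n^{s₀′−1}e^{−𝓛₂²log²(n/Dm)} = (Dm)⁻¹(Dm/n)^{s₀}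
  e^{−𝓛₂²log²(Dm/n)}` (`s₀′ = 1 − s₀`), and add the vanishing `n = 0` term.

## References

* Y. Zhang, arXiv:2211.02515v1 (2022), §15 p. 81 (proof of (15.4)). [cite: Zhang2022LandauSiegel, §15 p. 81]
-/

noncomputable section

open Complex Real ComplexConjugate MeasureTheory

namespace Literature.NumberTheory.LFunctions.Zhang2022.Typed.Section15A

open Literature.NumberTheory.LFunctions.Zhang2022.Skeleton

section U012a

variable (c' : ℝ) {D : ℕ} [NeZero D] (χ : DirichletCharacter ℂ D)

omit [NeZero D] in
/-- `s₀(−t₀) = 1 − s₀` (`s₀ = 1/2 + 2πit₀`). [cite: Zhang2022LandauSiegel, §2 (2.15)] -/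
theorem s0_neg_t0_eq : SmoothWeight.s0 (-t0 D) = 1 - s0 D := by
  rw [Skeleton.s0, SmoothWeight.s0_def, SmoothWeight.s0_def]; push_cast; ring

omit [NeZero D] in
/-- `((x/y))^s = x^s·(y^s)⁻¹` for positive reals `x, y` (real-axis arguments). [folklore] -/
private theorem ofReal_div_cpow {x y : ℝ} (hx : 0 < x) (hy : 0 < y) (s : ℂ) :
    (((x / y : ℝ)) : ℂ) ^ s = (x : ℂ) ^ s * ((y : ℂ) ^ s)⁻¹ := by
  have h1 : (((x / y : ℝ)) : ℂ) = ((x : ℝ) : ℂ) * (((y⁻¹ : ℝ)) : ℂ) := by push_cast; ring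
  rw [h1, Complex.mul_cpow_ofReal_nonneg hx.le (inv_nonneg.mpr hy.le)]
  have h2 : (((y⁻¹ : ℝ)) : ℂ) = ((y : ℂ))⁻¹ := by push_cast; rfl
  rw [h2, Complex.inv_cpow _ _ (by rw [Complex.arg_ofReal_of_nonneg hy.le]; exact Real.pi_pos.ne)]

/-- **The Gaussian factor in the two indexings**: for `m, n ≥ 1`,
`(Dm)^{−s₀′}·n^{s₀′−1}·e^{−𝓛₂²log²(n/(Dm))} = (Dm)⁻¹(Dm/n)^{s₀}e^{−𝓛₂²log²((Dm)/n)} = gaussU010 D n m`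
(`s₀′ = s₀(−t₀) = 1 − s₀`). [cite: Zhang2022LandauSiegel, §15 p. 81 (u010)] -/
theorem gauss_factor_eq {m n : ℕ} (hm : 0 < m) (hn : 0 < n) :
    (((D * m : ℕ) : ℂ) ^ SmoothWeight.s0 (-t0 D))⁻¹ * (n : ℂ) ^ (SmoothWeight.s0 (-t0 D) - 1) *
        cexp (-(ell2 D : ℂ) ^ 2 * (Real.log ((n : ℝ) / (D * m : ℕ)) : ℂ) ^ 2)
      = gaussU010 D n m := by
  have hD : 0 < D := Nat.pos_of_ne_zero (NeZero.ne D)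
  have hJ : 0 < D * m := Nat.mul_pos hD hm
  have hJ' : (0 : ℝ) < ((D * m : ℕ) : ℝ) := by exact_mod_cast hJ
  have hn' : (0 : ℝ) < n := by exact_mod_cast hn
  have hJc : ((D * m : ℕ) : ℂ) ≠ 0 := by exact_mod_cast hJ.ne'
  have hnc : (n : ℂ) ≠ 0 := by exact_mod_cast hn.ne'
  rw [gaussU010, s0_neg_t0_eq]
  -- the logarithms: `log(n/J)² = log(J/n)²`
  have hlog : (Real.log ((n : ℝ) / (D * m : ℕ)) : ℂ) ^ 2 = (Real.log (((D * m : ℕ) : ℝ) / n) : ℂ) ^ 2 := by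
    rw [← inv_div, Real.log_inv]; push_cast; ring
  have hexp : cexp (-(ell2 D : ℂ) ^ 2 * (Real.log ((n : ℝ) / (D * m : ℕ)) : ℂ) ^ 2) =
      (Real.exp (-(ell2 D ^ 2 * Real.log (((D * m : ℕ) : ℝ) / n) ^ 2)) : ℂ) := by
    rw [hlog, Complex.ofReal_exp]; push_cast; ring_nf
  rw [hexp]
  -- the powers
  have hpowJ : (((D * m : ℕ) : ℂ) ^ (1 - s0 D))⁻¹ = ((D * m : ℕ) : ℂ) ^ s0 D * (((D * m : ℕ) : ℂ))⁻¹ := by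
    rw [← Complex.cpow_neg, neg_sub, Complex.cpow_sub _ _ hJc, Complex.cpow_one, div_eq_mul_inv]
  have hpown : (n : ℂ) ^ ((1 : ℂ) - s0 D - 1) = ((n : ℂ) ^ s0 D)⁻¹ := by
    rw [show (1 : ℂ) - s0 D - 1 = -s0 D by ring, Complex.cpow_neg]
  have hquot : ((((D * m : ℕ) : ℝ) / n : ℝ) : ℂ) ^ s0 D = ((D * m : ℕ) : ℂ) ^ s0 D * ((n : ℂ) ^ s0 D)⁻¹ := by
    rw [ofReal_div_cpow hJ' hn']; push_cast; ring_nf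
  rw [hpowJ, hpown, hquot]
  ring

/-- **`Z22:§15.u012a` DISCHARGED** (the typer's exact identity node of the (15.4) chain): for `D` large and
`p ∼ P`, `Σ*_ψ (1/2πi)∫_{(−1/2)}(Σ_m k̃(m)ψ̄(Dm)(Dm)^{s−1})B(s,ψ)ω(s)ds
= Σ_{n<⌈PT⁻²⌉} Σ_m (χb)(n)k̃(m)·[Σ*_ψ ψ(n)ψ̄(Dm)]·(Dm)⁻¹(Dm/n)^{s₀}e^{−𝓛₂²log²(Dm/n)}`.
[cite: Zhang2022LandauSiegel, §15 p. 81 (proof of (15.4))] -/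
theorem step15_u012a_holds (c' : ℝ) : Step15_u012a c' := by
  refine ⟨⌈Real.exp 3⌉₊, fun D _ χ hD _ _ => ?_⟩
  intro p hp
  classical
  have hlog3 : 3 ≤ Real.log D := by
    have h : Real.exp 3 ≤ D := le_trans (Nat.le_ceil _) (by exact_mod_cast hD)
    exact (Real.le_log_iff_exp_le (lt_of_lt_of_le (Real.exp_pos 3) h)).mpr h
  have hℓ3 : 3 ≤ ell D := hlog3
  have hℓ : 0 < ell D := by linarith
  have hL := ell2_pos hℓ
  have hDne : D ≠ 0 := NeZero.ne D
  haveI : Fact p.Prime := ⟨(Finset.mem_filter.mp hp).2⟩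
  rw [sumPrim_integral_eq_tsum c' χ hℓ3 hp]
  set Nb : ℕ := ⌈bigP D / bigT D ^ 2⌉₊ with hNb
  set S : Finset ℕ := Finset.Ico 1 Nb with hS_def
  have hS : 0 ∉ S := by simp [hS_def]
  set s₁ : ℂ := SmoothWeight.s0 (-t0 D) with hs₁
  set a0 : ℕ → ℂ := fun j => if D ∣ j then ktilde c' D (j / D) else 0 with ha0
  set X : ℕ → ℕ → ℂ := fun j n =>
    ∑ ψ ∈ (Finset.univ : Finset (DirichletCharacter ℂ p)).erase 1, ψ (n : ZMod p) * ψ⁻¹ (j : ZMod p)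
    with hX
  set F : ℕ → ℕ → ℂ := fun j n => LSeries.term a0 s₁ j *
      (bcoef D n * χ (n : ZMod D) * (n : ℂ) ^ (s₁ - 1)) *
      cexp (-(ell2 D : ℂ) ^ 2 * (Real.log ((n : ℝ) / j) : ℂ) ^ 2) * X j n with hF
  -- the right-hand summand, and its agreement with `F (D m) n`
  have hXsum : ∀ j n : ℕ, (sumPrim fun (ψ : DirichletCharacter ℂ p) _ =>
      ψ (n : ZMod p) * conj (ψ ((j : ℕ) : ZMod p))) = X j n := by
    intro j n
    rw [sumPrim_eq_sum_erase_one]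
    refine Finset.sum_congr rfl fun ψ _ => ?_
    rw [PrimChar.inv_apply_eq_conj]
  have hterm : ∀ m n : ℕ, n ∈ S →
      F (D * m) n = bchi χ n * ktilde c' D m *
        (sumPrim fun (ψ : DirichletCharacter ℂ p) _ =>
          ψ (n : ZMod p) * conj (ψ ((D * m : ℕ) : ZMod p))) * gaussU010 D n m := by
    intro m n hn
    have hn1 : 0 < n := (Finset.mem_Ico.mp hn).1
    rcases Nat.eq_zero_or_pos m with rfl | hm
    · simp [hF, LSeries.term_zero, ktilde_zero]
    have hJ : D * m ≠ 0 := Nat.mul_ne_zero hDne hm.ne'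
    rw [hXsum, ← gauss_factor_eq (D := D) hm hn1]
    simp only [hF, ha0, LSeries.term_of_ne_zero hJ, if_pos (Dvd.intro m rfl),
      Nat.mul_div_cancel_left m (Nat.pos_of_ne_zero hDne), bchi]
    rw [div_eq_mul_inv]
    ring
  -- Step 1: the `j`-series lives on the multiples of `D`
  have hsupp : Function.support (fun j : ℕ => ∑ n ∈ S, F j n) ⊆ Set.range (fun m : ℕ => D * m) := by
    intro j hj
    rw [Function.mem_support] at hj
    by_cases hdvd : D ∣ j
    · obtain ⟨m, rfl⟩ := hdvd; exact ⟨m, rfl⟩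
    · exfalso; apply hj
      refine Finset.sum_eq_zero fun n _ => ?_
      have : LSeries.term a0 s₁ j = 0 := by
        rcases eq_or_ne j 0 with rfl | hj0
        · exact LSeries.term_zero _ _
        · rw [LSeries.term_of_ne_zero hj0]; simp [ha0, hdvd]
      simp [hF, this]
  rw [← (mul_right_injective₀ hDne).tsum_eq hsupp]
  -- Step 2: exchange `Σ'_m` and the finite `Σ_n`
  have hsum : ∀ n ∈ S, Summable (fun m : ℕ => F (D * m) n) := by
    intro n hn
    have h1 : Summable (fun j : ℕ => ∑ n' ∈ ({n} : Finset ℕ), F j n') := by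
      have h := SmoothWeight.summable_sum_term_mul hL (-t0 D) (lseriesSummable_aCoeff c' hℓ)
        (fun n => bcoef D n * χ (n : ZMod D)) (S := ({n} : Finset ℕ))
        (by
          rw [Finset.mem_singleton]
          have h1 := (Finset.mem_Ico.mp hn).1
          omega) X (Xb := (p : ℝ) - 1)
        (fun j n' _ => PrimChar.norm_sum_ne_one_le _ _)
      simpa only [hF] using h
    simp only [Finset.sum_singleton] at h1
    exact h1.comp_injective (mul_right_injective₀ hDne)
  rw [Summable.tsum_finsetSum hsum]
  -- Step 3: `Σ_{n ∈ range N_b} = ` the `n = 0` term (zero) `+ Σ_{n ∈ Ico 1 N_b}`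
  have hzero : ∑' m : ℕ, bchi χ 0 * ktilde c' D m *
      (sumPrim fun (ψ : DirichletCharacter ℂ p) _ =>
        ψ ((0 : ℕ) : ZMod p) * conj (ψ ((D * m : ℕ) : ZMod p))) * gaussU010 D 0 m = 0 := by
    have hb : bchi χ 0 = 0 := by simp [bchi, bcoef]
    simp [hb]
  rcases Nat.eq_zero_or_pos Nb with hNb0 | hNbpos
  · rw [hNb0]; simp [hS_def, hNb0]
  rw [Finset.range_eq_Ico, Finset.sum_eq_sum_Ico_succ_bot hNbpos, hzero, zero_add]
  refine Finset.sum_congr rfl fun n hn => tsum_congr fun m => hterm m n hn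

end U012a

end Literature.NumberTheory.LFunctions.Zhang2022.Typed.Section15A
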